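import Summits.CriticalPhenomena.SAWScalingLimit.Theorems.SAWDefectDecoherenceBoundaryClosureRPolygonLocalFlat
import Summits.CriticalPhenomena.SAWScalingLimit.Theorems.SAWDefectDecoherenceBoundaryClosureRPolygonLocalSums
import Summits.CriticalPhenomena.SAWScalingLimit.Theorems.SAWDefectDecoherenceBoundaryClosureRPolygonGreenPairing
import Mathlib.Analysis.Calculus.BumpFunction.FiniteDimension
import HarnessLib

/-!
# The local continuum identity for the limit functional: `η(∂̄φ) = -√3 n_k κ ∫ φ dμ`
(crux `BoundaryClosureR`, stmt-CriticalPhenomena-14004, line `polygon-parity-squeeze`, sub-goal of the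
registered stub `polygonLocalIdentity`, step (c) before the removal of the singular part; registered
helper `eta_dbar_eq_of_phases`)

Along a mesh sequence `ns → 0⁺` of an admissible pinned family with boundary layer budgets,
`DefectDecoherence` and `MassRatio`, let `η` be the limit of the normalised bulk functionals on tests off
the root and `μ` the limit of the normalised positive boundary measures.  On a flat boundary ball
`B(z, s)` of form `k` off the root, suppose the boundary darts near `z` carry phases `P_n`
(`F(vt)|F₀(b)| = P_n |F₀(vt)| F(b)` for `δ c_v ∈ B(z, 3s/4)`) converging to `κ₀` along some filter
`l ≤ atTop`.  Then for every smooth `φ` supported in `B(z, s/2)`: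

  `η(∂̄φ) = -√3 · n_k · κ₀ · ∫ φ dμ`.

Proof: the discrete Green pairing (`polygonGreenPairing`) and the bulk limit give
`6δ Σ_{darts} φ(δc_v)(mid - c_v)F/F(b) → η(∂̄φ)`; the dart term equals `-√3 n_k P_n · [dart mass
pairing]` (`dartSum_eq_phase_mul_massSum`, directions from `flat_dart_direction`); the dart mass pairing
is within `O(δ)` of the boundary mass pairing (`norm_massSum_darts_sub_boundary_le`), which tends to
`∫ φ dμ` (side limit on `Re φ`, `Im φ`).  References: Duminil-Copin–Smirnov 2012 §3.
No definition is introduced.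
-/

noncomputable section

open scoped BigOperators Topology ComplexConjugate ContDiff
open Filter Set Metric Complex MeasureTheory
open Literature.Probability.LatticeModels Literature.Probability.RandomPlanarGeometry
open Literature.Probability.RandomPlanarGeometry.SAW
open Literature.Analysis.Complex (dbarAlong continuous_dbarAlong_one tsupport_dbarAlong_one_subset
  hasCompactSupport_dbarAlong_one)
open Summit.CriticalPhenomena.SAWScalingLimit.Theses.SAWDefectDecoherence
open Summit.CriticalPhenomena.SAWScalingLimit.Theorems.PickHalfPlane
open Summit.CriticalPhenomena.SAWScalingLimit.Theorems.PolygonParitySqueeze.PolygonGreen (polygonGreenPairing)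

namespace Summit.CriticalPhenomena.SAWScalingLimit.Theorems.PolygonParitySqueeze.PolygonLocal

/-- A continuous compactly supported function is integrable against a measure that is finite on a
compact set carrying its support. [folklore] -/
theorem integrable_of_tsupport_subset {φ : ℂ → ℂ} (hφ : Continuous φ) {K : Set ℂ} (hK : IsCompact K)
    (hφK : tsupport φ ⊆ K) {μ : Measure ℂ} (hμ : μ K < ⊤) : Integrable φ μ := by
  have hφc : HasCompactSupport φ := IsCompact.of_isClosed_subset hK (isClosed_tsupport φ) hφK
  obtain ⟨M, hM⟩ := hφ.norm.bddAbove_range_of_hasCompactSupport hφc.norm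
  have h1 : IntegrableOn φ K μ := Measure.integrableOn_of_bounded hμ.ne hφ.aestronglyMeasurable
    (Eventually.of_forall fun w => hM ⟨w, rfl⟩)
  exact (integrableOn_iff_integrable_of_support_subset ((subset_tsupport φ).trans hφK)).1 h1

/-- **The local continuum identity for the limit functional** (sub-goal of `polygonLocalIdentity`):
see the module docstring. [cite: DuminilCopinSmirnov2012, §3 (Lemma 1, summation by parts)] -/
theorem eta_dbar_eq_of_phases : ∀ (D : DobrushinDomain) (ρ : ℝ) (Λ : ℝ → Finset HexVertex) (m : ℝ → ℤ) (b : ℝ → Sym2 HexVertex), AdmissibleFamily D ρ Λ m b → ∀ (a : ℝ → Sym2 HexVertex) (r₀ : ℝ) (m₀ : ℝ → ℤ), PinnedFlatRoot D Λ b (D.pt 0) a r₀ m₀ → (∀ z ∈ frontier D.carrier, z ≠ D.pt 0 → BoundaryLayerBudgetAt Λ a b z) → DefectDecoherence → MassRatio → ∀ (ns : ℕ → ℝ) (μ : MeasureTheory.Measure ℂ) (η : (ℂ → ℂ) → ℂ) (l : Filter ℕ), Filter.Tendsto ns Filter.atTop (𝓝[>] 0) → l ≤ Filter.atTop → l.NeBot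 → (∀ ψ : ℂ → ℂ, Continuous ψ → HasCompactSupport ψ → D.pt 0 ∉ tsupport ψ → Filter.Tendsto (fun n => NF Λ a b (ns n) ψ) Filter.atTop (𝓝 (η ψ))) → (∀ K : Set ℂ, IsCompact K → D.pt 0 ∉ K → μ K < ⊤) → (∀ w : ℂ → ℝ, Continuous w → HasCompactSupport w → D.pt 0 ∉ tsupport w → Filter.Tendsto (fun n => (ns n) * ∑ᶠ e ∈ hexDomainBoundary (Λ (ns n)), w (((ns n : ℝ) : ℂ) * hexMidpoint e) * (‖hexParafermionicObservable (Λ (ns n)) (a (ns n)) hexCriticalFugacity 0 e‖ / ‖hexParafermionicObservable (Λ (ns n)) (a (ns n)) hexCriticalFugacity 0 (b (ns n))‖)) Filter.atTop (𝓝 (∫ z, w z ∂μ))) → ∀ (z : ℂ) (k : Fin 6) (s : ℝ), 0 < s → (∀ᶠ δ : ℝ in 𝓝[>] 0, ∃ nthr : ℤ, ∀ v : HexVertex, (δ : ℂ) * hexCenter v ∈ Metric.ball z s → (v ∈ Λ δ ↔ nthr ≤ zigzagForm k v)) → D.pt 0 ∉ Metric.closedBall z s → ∀ (P : ℕ → ℂ)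 (κ₀ : ℂ), Filter.Tendsto P l (𝓝 κ₀) → (∀ᶠ n : ℕ in Filter.atTop, ∀ v t : HexVertex, v ∈ Λ (ns n) → t ∉ Λ (ns n) → hexGraph.Adj v t → ((ns n : ℝ) : ℂ) * hexCenter v ∈ Metric.ball z (3 * s / 4) → hexParafermionicObservable (Λ (ns n)) (a (ns n)) hexCriticalFugacity (5 / 8) s(v, t) * ((‖hexParafermionicObservable (Λ (ns n)) (a (ns n)) hexCriticalFugacity 0 (b (ns n))‖ : ℝ) : ℂ) = P n * ((‖hexParafermionicObservable (Λ (ns n)) (a (ns n)) hexCriticalFugacity 0 s(v, t)‖ : ℝ) : ℂ) * hexParafermionicObservable (Λ (ns n)) (a (ns n)) hexCriticalFugacity (5 / 8) (b (ns n))) → ∀ φ : ℂ → ℂ, ContDiff ℝ ∞ φ → HasCompactSupport φ → tsupport φ ⊆ Metric.ball z (s / 2) → η (Literature.Analysis.Complex.dbarAlong 1 φ) = -(Real.sqrt 3 : ℂ) * innerNormal k * κ₀ * ∫ w, φ w ∂μ := by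
  intro D ρ Λ m b hAF a r₀ m₀ hPR hBL hDD hMR ns μ η l hns hl hlne hbulk hmf hside z k s hs hex hroot P κ₀
    hP hphase φ hφ hφc hφs
  haveI := hlne
  ---------------------------------------------------------------- notation
  set F : ℕ → Sym2 HexVertex → ℂ := fun n e =>
    hexParafermionicObservable (Λ (ns n)) (a (ns n)) hexCriticalFugacity (5 / 8) e with hFdef
  set Z : ℕ → Sym2 HexVertex → ℝ := fun n e =>
    ‖hexParafermionicObservable (Λ (ns n)) (a (ns n)) hexCriticalFugacity 0 e‖ with hZdef
  set DS : ℕ → ℂ := fun n => ∑ᶠ p ∈ {p : HexVertex × HexVertex | p.1 ∈ Λ (ns n) ∧ p.2 ∉ Λ (ns n) ∧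
      hexGraph.Adj p.1 p.2}, φ (((ns n : ℝ) : ℂ) * hexCenter p.1) * (hexMidpoint s(p.1, p.2) - hexCenter p.1) *
      (F n s(p.1, p.2) / F n (b (ns n))) with hDS
  set MS : ℕ → ℂ := fun n => ((ns n : ℝ) : ℂ) * ∑ᶠ p ∈ {p : HexVertex × HexVertex | p.1 ∈ Λ (ns n) ∧
      p.2 ∉ Λ (ns n) ∧ hexGraph.Adj p.1 p.2}, φ (((ns n : ℝ) : ℂ) * hexCenter p.1) *
      ((Z n s(p.1, p.2) / Z n (b (ns n)) : ℝ) : ℂ) with hMS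
  set CBS : ℕ → ℂ := fun n => ((ns n : ℝ) : ℂ) * ∑ᶠ e ∈ hexDomainBoundary (Λ (ns n)),
      φ (((ns n : ℝ) : ℂ) * hexMidpoint e) * ((Z n e / Z n (b (ns n)) : ℝ) : ℂ) with hCBS
  set BS : (ℂ → ℝ) → ℕ → ℝ := fun w n => (ns n) * ∑ᶠ e ∈ hexDomainBoundary (Λ (ns n)),
      w (((ns n : ℝ) : ℂ) * hexMidpoint e) * (Z n e / Z n (b (ns n))) with hBS
  set ψ : ℂ → ℂ := dbarAlong 1 φ with hψdef
  ---------------------------------------------------------------- test function facts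
  have hφ1 : ContDiff ℝ 1 φ := hφ.of_le (by
    change ((1 : ℕ∞) : WithTop ℕ∞) ≤ ((⊤ : ℕ∞) : WithTop ℕ∞); exact WithTop.coe_le_coe.2 le_top)
  have hsub1 : ball z (s / 2) ⊆ ball z (3 * s / 4) := ball_subset_ball (by linarith)
  have hφ0 : D.pt 0 ∉ tsupport φ := fun h =>
    hroot (ball_subset_closedBall (ball_subset_ball (by linarith) (hφs h)))
  have hψc : Continuous ψ := continuous_dbarAlong_one hφ1
  have hψs : HasCompactSupport ψ := hasCompactSupport_dbarAlong_one hφc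
  have hψ0 : D.pt 0 ∉ tsupport ψ := fun h => hφ0 (tsupport_dbarAlong_one_subset φ h)
  ---------------------------------------------------------------- Steps 1–3: the dart term → η(∂̄φ)
  have T1 : Tendsto (fun n => NF Λ a b (ns n) ψ - 6 * ((ns n : ℝ) : ℂ) * DS n) atTop (𝓝 0) :=
    (polygonGreenPairing D ρ Λ m b hAF a r₀ m₀ hPR hBL hDD hMR φ hφ hφc hφ0).comp hns
  have T2 : Tendsto (fun n => NF Λ a b (ns n) ψ) atTop (𝓝 (η ψ)) := hbulk ψ hψc hψs hψ0
  have T3 : Tendsto (fun n => 6 * ((ns n : ℝ) : ℂ) * DS n) atTop (𝓝 (η ψ)) := by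
    have h := T2.sub T1
    rw [sub_zero] at h
    exact h.congr fun n => sub_sub_cancel _ _
  ---------------------------------------------------------------- Step 4: phase factorisation, eventually
  have hs34 : 3 * s / 4 < s := by linarith
  have hdir := hns.eventually (flat_dart_direction hAF hPR hs34 hex hroot)
  have hnorm := hns.eventually (boundary_norms hAF hPR)
  have hpos := hns.eventually (self_mem_nhdsWithin : Ioi (0 : ℝ) ∈ 𝓝[>] (0 : ℝ))
  have T4 : ∀ᶠ n in atTop, 6 * ((ns n : ℝ) : ℂ) * DS n = -(Real.sqrt 3 : ℂ) * innerNormal k * P n * MS n := by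
    filter_upwards [hdir, hnorm, hphase] with n hd hn hp
    obtain ⟨hne, hbmem⟩ := hn
    have hZb : Z n (b (ns n)) ≠ 0 := (hne _ hbmem).2.ne'
    have hFb : F n (b (ns n)) ≠ 0 := by
      intro h0
      have := (hne _ hbmem).1
      simp only [hFdef] at h0
      rw [h0, norm_zero] at this
      exact hZb (by simp only [hZdef]; exact this.symm)
    exact dartSum_eq_phase_mul_massSum (Λ (ns n)) (a (ns n)) (b (ns n)) (ns n) φ z (3 * s / 4) k (P n)
      (hφs.trans hsub1) hFb hZb hd hp
  ---------------------------------------------------------------- Step 5: the mass pairing → ∫ φ dμ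
  -- (5a) Lipschitz constant and the bump `w₀`
  obtain ⟨Kφ, hKφ⟩ := hφ1.lipschitzWith_of_hasCompactSupport hφc one_ne_zero
  have hlip : ∀ x y, ‖φ x - φ y‖ ≤ (Kφ : ℝ) * ‖x - y‖ := fun x y => by
    rw [← dist_eq_norm, ← dist_eq_norm]; exact hKφ.dist_le_mul x y
  let β : ContDiffBump z := ⟨3 * s / 4, 7 * s / 8, by linarith, by linarith⟩
  set w₀ : ℂ → ℝ := fun x => β x with hw₀
  have hw₀c : Continuous w₀ := β.continuous
  have hw₀s : HasCompactSupport w₀ := β.hasCompactSupport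
  have hw₀0 : D.pt 0 ∉ tsupport w₀ := by
    rw [hw₀, β.tsupport_eq]
    exact fun h => hroot (closedBall_subset_closedBall (by show 7 * s / 8 ≤ s; linarith) h)
  have hw₀nn : ∀ y, 0 ≤ w₀ y := fun y => β.nonneg
  have Tw₀ : Tendsto (BS w₀) atTop (𝓝 (∫ x, w₀ x ∂μ)) := hside w₀ hw₀c hw₀s hw₀0
  -- (5b) the dart mass pairing is close to the boundary mass pairing
  have hsmall : ∀ᶠ n in atTop, ns n < s / 4 := hns.eventually (nhdsWithin_le_nhds (eventually_lt_nhds (by linarith)))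
  have T5b : ∀ᶠ n in atTop, ‖MS n - CBS n‖ ≤ (Kφ : ℝ) * ns n / 2 * BS w₀ n := by
    filter_upwards [hpos, hsmall] with n hn0 hns4
    refine norm_massSum_darts_sub_boundary_le (Λ (ns n)) (a (ns n)) (b (ns n)) (le_of_lt hn0) φ w₀
      (Kφ).2 hlip hw₀nn fun y y' hy hyy' => ?_
    have hyb : y ∈ ball z (s / 2) := hφs (subset_tsupport φ hy)
    apply β.one_of_mem_closedBall
    show y' ∈ closedBall z (3 * s / 4)
    rw [mem_closedBall]
    rw [mem_ball] at hyb
    have := dist_triangle y' y z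
    linarith
  have T5b' : Tendsto (fun n => MS n - CBS n) atTop (𝓝 0) := by
    have hbd : ∀ᶠ n in atTop, BS w₀ n ≤ (∫ x, w₀ x ∂μ) + 1 :=
      Tw₀.eventually (eventually_le_nhds (lt_add_one _))
    have hmaj : Tendsto (fun n => (Kφ : ℝ) * ns n / 2 * ((∫ x, w₀ x ∂μ) + 1)) atTop (𝓝 0) := by
      have h0 : Tendsto ns atTop (𝓝 0) := tendsto_nhdsWithin_iff.1 hns |>.1
      have : Tendsto (fun n => (Kφ : ℝ) * ns n / 2 * ((∫ x, w₀ x ∂μ) + 1)) atTop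
          (𝓝 ((Kφ : ℝ) * 0 / 2 * ((∫ x, w₀ x ∂μ) + 1))) :=
        ((tendsto_const_nhds.mul h0).div_const 2).mul tendsto_const_nhds
      simpa using this
    rw [tendsto_zero_iff_norm_tendsto_zero]
    refine squeeze_zero' (Eventually.of_forall fun n => norm_nonneg _) ?_ hmaj
    filter_upwards [T5b, hbd, hpos] with n h1 h2 hn0
    refine h1.trans ?_
    have : 0 ≤ (Kφ : ℝ) * ns n / 2 := by have := (Kφ).2; positivity
    exact mul_le_mul_of_nonneg_left h2 this
  -- (5c) the boundary mass pairing → ∫ φ dμ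
  have hre : Tendsto (BS fun x => (φ x).re) atTop (𝓝 (∫ x, (φ x).re ∂μ)) :=
    hside _ (Complex.continuous_re.comp hφ.continuous) (hφc.comp_left Complex.zero_re)
      fun h => hφ0 (tsupport_comp_subset Complex.zero_re φ h)
  have him : Tendsto (BS fun x => (φ x).im) atTop (𝓝 (∫ x, (φ x).im ∂μ)) :=
    hside _ (Complex.continuous_im.comp hφ.continuous) (hφc.comp_left Complex.zero_im)
      fun h => hφ0 (tsupport_comp_subset Complex.zero_im φ h)
  have hint : Integrable φ μ :=
    integrable_of_tsupport_subset hφ.continuous (isCompact_closedBall z (s / 2))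
      (hφs.trans ball_subset_closedBall) (hmf _ (isCompact_closedBall z (s / 2))
        fun h => hroot (closedBall_subset_closedBall (by linarith) h))
  have hsplit : ∀ n, CBS n = ((BS (fun x => (φ x).re) n : ℝ) : ℂ) + ((BS (fun x => (φ x).im) n : ℝ) : ℂ) * I :=
    fun n => boundarySum_re_add_im (Λ (ns n)) (a (ns n)) (b (ns n)) (ns n) φ
  have T5c : Tendsto CBS atTop (𝓝 (∫ x, φ x ∂μ)) := by
    have h := integral_re_add_im (𝕜 := ℂ) hint
    simp only [RCLike.re_to_complex, RCLike.im_to_complex, RCLike.I_to_complex] at h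
    rw [← h]
    have e : CBS = fun n => ((BS (fun x => (φ x).re) n : ℝ) : ℂ) + ((BS (fun x => (φ x).im) n : ℝ) : ℂ) * I :=
      funext hsplit
    rw [e]
    exact ((Complex.continuous_ofReal.tendsto _).comp hre).add
      (((Complex.continuous_ofReal.tendsto _).comp him).mul tendsto_const_nhds)
  have T5 : Tendsto MS atTop (𝓝 (∫ x, φ x ∂μ)) := by
    have := T5b'.add T5c
    rw [zero_add] at this
    exact this.congr fun n => sub_add_cancel _ _
  ---------------------------------------------------------------- Step 6: limits along `l`
  have T6 : Tendsto (fun n => -(Real.sqrt 3 : ℂ) * innerNormal k * P n * MS n) l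
      (𝓝 (-(Real.sqrt 3 : ℂ) * innerNormal k * κ₀ * ∫ x, φ x ∂μ)) :=
    ((tendsto_const_nhds.mul hP).mul (T5.mono_left hl))
  have T3' : Tendsto (fun n => 6 * ((ns n : ℝ) : ℂ) * DS n) l (𝓝 (η ψ)) := T3.mono_left hl
  have T4' : ∀ᶠ n in l, 6 * ((ns n : ℝ) : ℂ) * DS n = -(Real.sqrt 3 : ℂ) * innerNormal k * P n * MS n :=
    T4.filter_mono hl
  exact tendsto_nhds_unique (T3'.congr' T4') T6

end Summit.CriticalPhenomena.SAWScalingLimit.Theorems.PolygonParitySqueeze.PolygonLocal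

end
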